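import Summits.ResolutionOfSingularities.ResolutionOfSingularities.Theorems.ValuativeLuAlphaPTorsorAPFlagFinal
import Literature.AlgebraicGeometry.Resolution.AbhyankarValuationsLocalUniformization
import HarnessLib

/-!
# Relative local uniformization of an Abhyankar subfunction field, any ground field

Crux `Valuative.LuAlphaPTorsor` (item `stmt-ResolutionOfSingularities-0641`), line
`pfaff-line-log-final-forms`, stub R0 `stub_relLUAbhyankarSubfield` of the skeleton reshape v6.8.

Setting: `k ⊆ K` fields, `k` of characteristic `p`, `O ⊇ k` a valuation ring of `K` which is
zero-dimensional over `k` (every element of `O` satisfies a non-zero polynomial over `k` with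
value in the maximal ideal), `F₀` a subfield of `K` with `im k ≤ F₀`, finitely generated over
`im k` (`FGOver`), on which `O` induces an Abhyankar place of `F₀ / k`
(`IsAbhyankarPlace O (im k) F₀`).

**Claim** (`stub_relLUAbhyankarSubfield`). Every finite `Z ⊆ O ∩ F₀` lies in a finitely
generated `k`-subalgebra `B ⊆ O ∩ F₀` of `K` with `Frac B = F₀` whose local ring at the centre
`𝔪_O ∩ B` of `O` is regular.

Proof. View `F₀` as an intermediate field `M` of `K / k` and value it by
`O' := O ∩ M = O.comap (M → K)`. The hypotheses of the line's any-ground-field theorem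
`relLU_zeroDim_abhyankar` (relative local uniformization at zero-dimensional Abhyankar places of
any rank) hold for `(k, M, O')`: `M / k` is finitely generated, `O'` is zero-dimensional (the same
polynomials), and `O'` is an Abhyankar place of `M / k` — the elementary Abhyankar data
`x, y ∈ F₀` pull back along the embedding `M → K` together with the `ℤ`-independence of the
values (`valuation_map_eq_iff`), the algebraic independence of the residues (the residue field of
`O'` embeds into that of `O`) and the algebraicity of `F₀` over `k(x, y)`
(`isAlgebraic_adjoin_map_iff`): `isAbhyankarPlace_of_map`, the converse of the tree's
`isAbhyankarPlace_map`. Applied to `S := k[Z]` it yields a finitely generated `A ⊆ O'` with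
`Frac A = M`, regular at the centre of `O'`; its image `B ⊆ K` is the required model
(`A ≅ B` carries centre to centre, `mk_mem_maximalIdeal_comap_iff`,
`isRegularLocalRing_localization_iff_of_ringEquiv`).
-/

-- single-problem summit: the doubled namespace component `ResolutionOfSingularities` is forced
set_option linter.dupNamespace false

namespace Summit.ResolutionOfSingularities.ResolutionOfSingularities.Theorems.PfaffLine

open IsLocalRing Literature.AlgebraicGeometry.Resolution

/-- **Abhyankar places pull back along field embeddings** (converse of `isAbhyankarPlace_map`):
if `ι⁻¹(V') = V` and `(ι(F)|ι(K), V')` is an Abhyankar place, then so is `(F|K, V)` — the data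
`x, y ∈ ι(F)` pull back to `F`; `ℤ`-independence of the values (`valuation_map_eq_iff`),
algebraic independence of the residues (along the embedding of residue fields induced by the
local homomorphism `V → V'`) and algebraicity over `K(x, y)` (`isAlgebraic_adjoin_map_iff`) are
transported back. [folklore] -/
theorem isAbhyankarPlace_of_map {Ω Ω' : Type*} [Field Ω] [Field Ω'] (ι : Ω →+* Ω')
    {V : ValuationSubring Ω} {V' : ValuationSubring Ω'} (hV : V'.comap ι = V) {K F : Subfield Ω}
    (h : IsAbhyankarPlace V' (K.map ι) (F.map ι)) : IsAbhyankarPlace V K F := by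
  classical
  obtain ⟨ρ, τ, x', y', hy', hxF', hyF', hxi', hri', halg'⟩ := h
  have hmemV' : ∀ a : Ω, ι a ∈ V' ↔ a ∈ V := fun a => by
    rw [← ValuationSubring.mem_comap, hV]
  -- pull the data back to `Ω`
  have hxe : ∀ i, ∃ a : Ω, a ∈ F ∧ ι a = x' i := fun i => Subfield.mem_map.mp (hxF' i).1
  have hye : ∀ j, ∃ a : Ω, a ∈ F ∧ ι a = y' j := fun j => Subfield.mem_map.mp (hyF' j)
  choose x hxF hx using hxe
  choose y hyF hyy using hye
  have hy : ∀ j, y j ∈ V := fun j => (hmemV' _).mp ((hyy j).symm ▸ hy' j)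
  -- the residue map `κ(V) → κ(V')`
  let φ : V →+* V' :=
    { toFun := fun a => ⟨ι (a : Ω), (hmemV' _).mpr a.2⟩
      map_one' := Subtype.ext (map_one ι)
      map_mul' := fun a b => Subtype.ext (map_mul ι (a : Ω) (b : Ω))
      map_zero' := Subtype.ext (map_zero ι)
      map_add' := fun a b => Subtype.ext (map_add ι (a : Ω) (b : Ω)) }
  haveI : IsLocalHom φ := by
    refine ⟨fun a ha => ?_⟩
    rw [ValuationSubring.valuation_eq_one_iff] at ha ⊢
    change V'.valuation (ι a) = 1 at ha
    exact (valuation_map_eq_one_iff ι hV a).mp ha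
  let g : ResidueField V →+* ResidueField V' := IsLocalRing.ResidueField.map φ
  have hg : ∀ a : V, g (residue V a) = residue V' (φ a) := fun a =>
    IsLocalRing.ResidueField.map_residue φ a
  have hgK : ∀ r ∈ resField V K, g r ∈ resField V' (K.map ι) := by
    intro r hr
    obtain ⟨a, haK, rfl⟩ := (mem_resField_iff V K r).mp hr
    rw [hg]
    exact residue_mem_resField V' (φ a) (Subfield.mem_map.mpr ⟨a, haK, rfl⟩)
  let f : resField V K →+* resField V' (K.map ι) :=
    (g.comp (resField V K).subtype).codRestrict _ fun r => hgK r r.2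
  have hcomp : (algebraMap (resField V' (K.map ι)) (ResidueField V')).comp f =
      g.comp (algebraMap (resField V K) (ResidueField V)) := RingHom.ext fun _ => rfl
  have hri : AlgebraicIndependent (resField V K) (fun j => residue V ⟨y j, hy j⟩) := by
    refine AlgebraicIndependent.of_ringHom_of_comp_eq f g ?_ f.injective hcomp
    have h2 : (⇑g ∘ fun j => residue V ⟨y j, hy j⟩) = fun j => residue V' ⟨y' j, hy' j⟩ := by
      funext j
      simp only [Function.comp_apply]
      rw [hg]
      congr 1
      exact Subtype.ext (hyy j)
    rw [h2]
    exact hri'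
  have hxc : (⇑ι ∘ x) = x' := funext hx
  have hyc : (⇑ι ∘ y) = y' := funext hyy
  refine ⟨ρ, τ, x, y, hy, fun i => ⟨hxF i, fun h0 => (hxF' i).2 ?_⟩, hyF, ?_, hri, ?_⟩
  · rw [← hx i, h0, map_zero]
  · rintro m ⟨b, hbK, hb⟩
    refine hxi' m ⟨ι b, Subfield.mem_map.mpr ⟨b, hbK, rfl⟩, ?_⟩
    have hprod : (∏ i, V'.valuation (x' i) ^ m i) = V'.valuation (ι (∏ i, x i ^ m i)) := by
      rw [map_prod, map_prod]
      simp_rw [map_zpow₀, hx]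
    rw [hprod, valuation_map_eq_iff ι hV, ← hb, map_prod]
    simp_rw [map_zpow₀]
  · intro z hzF
    have hset : Set.range x' ∪ Set.range y' = ι '' (Set.range x ∪ Set.range y) := by
      rw [Set.image_union, ← Set.range_comp, ← Set.range_comp, hxc, hyc]
    have h1 := halg' (ι z) (Subfield.mem_map.mpr ⟨z, hzF, rfl⟩)
    rw [hset] at h1
    exact (isAlgebraic_adjoin_map_iff ι K _ z).mp h1

/-- **Relative local uniformization of an Abhyankar intermediate field, any ground field** (the
line's `relLU_zeroDim_abhyankar` on an intermediate field `M` of `K / k`, pushed into `K`): if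
`O ⊇ k` is zero-dimensional over `k`, `M / k` is finitely generated and `O ∩ M` is an Abhyankar
place of `M / k`, then every finite `Z ⊆ O ∩ M` lies in a finitely generated `k`-subalgebra
`B ⊆ O ∩ M` with `Frac B = M`, regular at the centre of `O`. [folklore] -/
theorem relLU_zeroDim_abhyankar_intermediateField (p : ℕ) (hp : p.Prime) (k K : Type) [Field k]
    [CharP k p] [Field K] [Algebra k K] (O : ValuationSubring K)
    (hk : ∀ c : k, algebraMap k K c ∈ O)
    (hzd : ∀ x : K, x ∈ O → ∃ f : Polynomial k, f ≠ 0 ∧ Polynomial.aeval x f ∈ O.nonunits)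
    (M : IntermediateField k K) (hfgM : (⊤ : IntermediateField k M).FG)
    (hA : IsAbhyankarPlace O (algebraMap k K).fieldRange M.toSubfield) (Z : Finset K)
    (hZ : ∀ z ∈ Z, z ∈ O ∧ z ∈ M) :
    ∃ (B : Subalgebra k K) (hB : B.toSubring ≤ O.toSubring), (B : Set K) ⊆ M ∧ (Z : Set K) ⊆ B ∧
      B.FG ∧ (∀ x ∈ M, ∃ a ∈ B, ∃ b ∈ B, x = a / b) ∧
      IsRegularLocalRing (Localization.AtPrime
        (Ideal.comap (Subring.inclusion hB) (IsLocalRing.maximalIdeal O))) := by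
  classical
  have hmemO' : ∀ z : M, z ∈ O.comap (algebraMap M K) ↔ (z : K) ∈ O := fun z =>
    ValuationSubring.mem_comap
  -- the hypotheses of `relLU_zeroDim_abhyankar` for `(k, M, O ∩ M)`
  have hk' : ∀ c : k, algebraMap k M c ∈ O.comap (algebraMap M K) := fun c => by
    rw [ValuationSubring.mem_comap, ← IsScalarTower.algebraMap_apply]
    exact hk c
  have hzd' : ∀ x : M, x ∈ O.comap (algebraMap M K) →
      ∃ f : Polynomial k, f ≠ 0 ∧ Polynomial.aeval x f ∈ (O.comap (algebraMap M K)).nonunits := by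
    intro x hx
    obtain ⟨f, hf0, hf⟩ := hzd (x : K) ((hmemO' x).mp hx)
    refine ⟨f, hf0, ?_⟩
    rw [ValuationSubring.mem_nonunits_iff, IntermediateField.aeval_coe] at hf
    rw [ValuationSubring.mem_nonunits_iff, ← valuation_map_lt_one_iff (algebraMap M K) rfl]
    exact hf
  have hA' : IsAbhyankarPlace (O.comap (algebraMap M K)) (algebraMap k M).fieldRange ⊤ := by
    refine isAbhyankarPlace_of_map (algebraMap M K) rfl ?_
    have h1 : (algebraMap k M).fieldRange.map (algebraMap M K) = (algebraMap k K).fieldRange := by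
      rw [RingHom.map_fieldRange, ← IsScalarTower.algebraMap_eq]
    have h2 : (⊤ : Subfield M).map (algebraMap M K) = M.toSubfield := by
      ext z
      constructor
      · rintro ⟨w, -, rfl⟩
        exact w.2
      · intro hz
        exact ⟨⟨z, hz⟩, trivial, rfl⟩
    rw [h1, h2]
    exact hA
  -- the finite set, pulled back to `M`, and the subalgebra it generates
  let Z' : Finset M := Z.preimage (fun z : M => (z : K)) Subtype.val_injective.injOn
  have hZ' : ∀ z : M, z ∈ Z' ↔ (z : K) ∈ Z := fun z => Finset.mem_preimage
  let OM : Subalgebra k M :=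
    { (O.comap (algebraMap M K)).toSubring with
      algebraMap_mem' := fun c => hk' c }
  have hmemOM : ∀ z : M, z ∈ OM ↔ z ∈ O.comap (algebraMap M K) := fun z => Iff.rfl
  have hS'le : Algebra.adjoin k (Z' : Set M) ≤ OM := by
    refine Algebra.adjoin_le fun z hz => ?_
    rw [Finset.mem_coe, hZ'] at hz
    exact (hmemOM z).mpr ((hmemO' z).mpr (hZ _ hz).1)
  have hS'O : (Algebra.adjoin k (Z' : Set M)).toSubring ≤ (O.comap (algebraMap M K)).toSubring :=
    fun z hz => hS'le hz
  obtain ⟨A, h, hSA, hAfg, hfrac, hreg⟩ :=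
    relLU_zeroDim_abhyankar p hp k M (O.comap (algebraMap M K)) hk' hfgM hzd' hA'
      (Algebra.adjoin k (Z' : Set M)) (Subalgebra.fg_adjoin_finset Z') hS'O
  -- push the model forward into `K`
  let B : Subalgebra k K := A.map M.val
  have hmemB : ∀ z : K, z ∈ B ↔ ∃ a ∈ A, (a : K) = z := fun z => Subalgebra.mem_map
  have hBO : B.toSubring ≤ O.toSubring := by
    intro z hz
    obtain ⟨a, ha, rfl⟩ := (hmemB z).mp hz
    exact (hmemO' a).mp (h ha)
  refine ⟨B, hBO, ?_, ?_, hAfg.map _, ?_, ?_⟩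
  · -- `B ⊆ M`
    intro z hz
    obtain ⟨a, -, rfl⟩ := (hmemB z).mp hz
    exact a.2
  · -- `Z ⊆ B`
    intro z hz
    have hzM : z ∈ M := (hZ z hz).2
    refine (hmemB z).mpr ⟨⟨z, hzM⟩, hSA (Algebra.subset_adjoin ?_), rfl⟩
    rw [Finset.mem_coe, hZ']
    exact hz
  · -- `Frac B = M`
    intro x hx
    haveI := hfrac
    obtain ⟨a, b, -, hab⟩ := IsFractionRing.div_surjective (A := A) (⟨x, hx⟩ : M)
    refine ⟨((a : M) : K), (hmemB _).mpr ⟨a, a.2, rfl⟩, ((b : M) : K),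
      (hmemB _).mpr ⟨b, b.2, rfl⟩, ?_⟩
    have := congrArg (algebraMap M K) hab
    rw [map_div₀] at this
    exact this.symm
  · -- regular at the centre: `A ≅ B` carries centre to centre
    have hmapS : A.toSubring.map (algebraMap M K) = B.toSubring := by
      ext z
      simp only [Subring.mem_map, Subalgebra.mem_toSubring, hmemB]
      constructor
      · rintro ⟨a, ha, rfl⟩
        exact ⟨a, ha, rfl⟩
      · rintro ⟨a, ha, rfl⟩
        exact ⟨a, ha, rfl⟩
    let e : A.toSubring ≃+* B.toSubring :=
      (A.toSubring.equivMapOfInjective (algebraMap M K) (algebraMap M K).injective).trans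
        (RingEquiv.subringCongr hmapS)
    have he : ∀ a : A.toSubring, ((e a : B.toSubring) : K) = algebraMap M K a := fun _ => rfl
    set P : Ideal B.toSubring := Ideal.comap (Subring.inclusion hBO) (maximalIdeal O) with hP
    haveI hPp : P.IsPrime := Ideal.comap_isPrime _ _
    have hPe : P.comap (e : A.toSubring →+* B.toSubring) =
        Ideal.comap (Subring.inclusion h) (maximalIdeal (O.comap (algebraMap M K))) := by
      ext a
      have h2 : Subring.inclusion hBO (e a) = ⟨algebraMap M K a, hBO (e a).2⟩ :=
        Subtype.ext (he a)
      simp only [Ideal.mem_comap, hP, RingHom.coe_coe]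
      rw [h2]
      exact (mk_mem_maximalIdeal_comap_iff O (algebraMap M K) (h a.2)).symm
    haveI : (P.comap (e : A.toSubring →+* B.toSubring)).IsPrime := Ideal.comap_isPrime _ _
    exact (isRegularLocalRing_localization_iff_of_ringEquiv e P).mpr
      (isRegularLocalRing_localization_atPrime_congr hPe.symm hreg)

/-- **Relative local uniformization of the Abhyankar SUBFIELD `F₀`, any ground field** (stub R0
of the line `pfaff-line-log-final-forms`, reshape v6.8): the line's `relLU_zeroDim_abhyankar`
(every ground field `k` of characteristic `p`) applied to the function field `F₀ / k`
(zero-dimensional for `O ∩ F₀` because `O` is; Abhyankar by hypothesis) and pushed back into `K`: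
every finite `Z ⊆ O ∩ F₀` lies in a finitely generated `k`-subalgebra `B ⊆ O ∩ F₀` with
`Frac B = F₀`, regular at the centre of `O` (`relLU_zeroDim_abhyankar_intermediateField` for
`F₀` viewed as an intermediate field of `K / k`). [folklore] -/
theorem stub_relLUAbhyankarSubfield :
    ∀ p : ℕ, p.Prime → ∀ (k K : Type) [Field k] [CharP k p] [Field K] [Algebra k K] (O : ValuationSubring K), (∀ c : k, algebraMap k K c ∈ O) → (∀ x : K, x ∈ O → ∃ f : Polynomial k, f ≠ 0 ∧ Polynomial.aeval x f ∈ O.nonunits) → ∀ F₀ : Subfield K, (algebraMap k K).fieldRange ≤ F₀ → Literature.AlgebraicGeometry.Resolution.FGOver (algebraMap k K).fieldRange F₀ → Literature.AlgebraicGeometry.Resolution.IsAbhyankarPlace O (algebraMap k K).fieldRange F₀ → ∀ Z : Finset K, (∀ z ∈ Z, z ∈ O ∧ z ∈ F₀) → ∃ (B : Subalgebra k K) (hB : B.toSubring ≤ O.toSubring), (B : Set K) ⊆ F₀ ∧ (Z : Set K) ⊆ B ∧ B.FG ∧ (∀ x ∈ F₀, ∃ a ∈ B, ∃ b ∈ B,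 x = a / b) ∧ IsRegularLocalRing (Localization.AtPrime (Ideal.comap (Subring.inclusion hB) (IsLocalRing.maximalIdeal O))) := by
  intro p hp k K _ _ _ _ O hk hzd F₀ hkF₀ hfg hA Z hZ
  have hkF₀' : ∀ c : k, algebraMap k K c ∈ F₀ := fun c => hkF₀ ⟨c, rfl⟩
  -- `F₀ / k` is finitely generated, as an intermediate field
  have hMfg : (F₀.toIntermediateField hkF₀').FG := by
    obtain ⟨s, hs⟩ := hfg
    refine ⟨s, IntermediateField.toSubfield_injective ?_⟩
    rw [IntermediateField.adjoin_toSubfield, ← RingHom.coe_fieldRange, hs]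
    rfl
  have hfgM : (⊤ : IntermediateField k (F₀.toIntermediateField hkF₀')).FG :=
    IntermediateField.fg_top_iff.mpr (IntermediateField.essFiniteType_iff.mpr hMfg)
  exact relLU_zeroDim_abhyankar_intermediateField p hp k K O hk hzd (F₀.toIntermediateField hkF₀')
    hfgM hA Z hZ

end Summit.ResolutionOfSingularities.ResolutionOfSingularities.Theorems.PfaffLine
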